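import Summits.AtomisticToContinuum.Crystallization.Theses.PhononSlackCertificates
import Summits.AtomisticToContinuum.Crystallization.Theorems.PhononSlackCertificatesCoerciveTwoShellGapTorusSlice

/-!
# Route `PhononSlackCertificates`, crux `CoerciveTwoShellGap` (stmt-AtomisticToContinuum-13956),
# line `Sketch`: the SANDWICH around card A's core `stub_torusQMC`

Card A's C⁺ on the torus (`stub_torusQMC` of `Cruxes/CoerciveTwoShellGap/Lines/Sketch.lean`):
some `c > 0` makes every periodic configuration `P` of `ℝ³` with `1/3`-separated point set pay
`c` times the motif mean of the floored, capped squared misfit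
`m_y := sSup ({0} ∪ {ε² − (1/50)² : 1/50 < ε ≤ 3/20, y is ε-bad in P.points})` above
`e* = ⨅_Q e(Q)`.  Write `TorusGap(ε, g)` for the torus two-shell gap at tolerance `ε` and price
`g`: `e* + g · #{y ∈ motif : y is ε-bad in P.points} / #motif ≤ e(P)` for the same `P`.

This file records, kernel-checked, that C⁺ is NOT a differently-natured statement but the torus
two-shell gap read at tolerance `1/50⁺`:

* `torusQMC_of_torusGap_fiftieth`:  `(∃ g > 0, TorusGap(1/50, g)) → C⁺` with
  `c = g / ((3/20)² − (1/50)²)`, because pointwise `m_y ≤ ((3/20)² − (1/50)²)·[y is 1/50-bad]`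
  (`misfitSet_sSup_eq_zero_of_good`, `misfitSet_sSup_le`): a `1/50`-good point is `ε`-good for
  every `ε ≥ 1/50` (`IsTwoShellGoodSet.mono`), so its misfit set is `{0}`.
* `torusGap_of_torusQMC`:  `C⁺ → ∃ g > 0, TorusGap(ε, g)` for EVERY `ε ∈ (1/50, 3/20]`, with
  `g = c (ε² − (1/50)²)` (the landed slice `stub_torusSlice` is the instance `ε = 1/20`).
* `torusGap_mono`:  `TorusGap(ε, g) → TorusGap(ε', g)` for `ε ≤ ε'` (bad sets shrink).

So `TorusGap(1/50) ⇒ C⁺ ⇒ TorusGap(ε)` for all `ε > 1/50`, while the crux is `⇔ TorusGap(1/20)`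
(`CoerciveTwoShellGapBlocks.coerciveTwoShellGap_iff_torusTwoShellGap`, p101526): card A's core is
the crux at a `2.5×` tighter tolerance, up to constants — strictly stronger, not better
conditioned.  No definition, no named fact; all `[folklore]`.
-/

noncomputable section

namespace Summit.AtomisticToContinuum.Crystallization.Theorems.CoerciveTwoShellGapSandwich

open scoped BigOperators Classical
open Literature.MathematicalPhysics.StatisticalMechanics Literature.Geometry.DiscreteGeometry
open Summit.AtomisticToContinuum.Crystallization.Theorems.CoerciveTwoShellGapTorusSlice

/-- The misfit set of a point is non-empty (it contains `0`). [folklore] -/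
theorem misfitSet_nonempty (Y : Set (EuclideanSpace ℝ (Fin 3))) (y : EuclideanSpace ℝ (Fin 3)) :
    ({0} ∪ {t : ℝ | ∃ ε : ℝ, 1 / 50 < ε ∧ ε ≤ 3 / 20 ∧ t = ε ^ 2 - (1 / 50) ^ 2 ∧
      ¬ IsTwoShellGoodSet ε (47 / 50) 1 Y y}).Nonempty :=
  ⟨0, Set.mem_union_left _ (Set.mem_singleton 0)⟩

/-- **Cap.**  The supremum of the misfit set of any point is at most `(3/20)² − (1/50)²`.
[folklore] -/
theorem misfitSet_sSup_le (Y : Set (EuclideanSpace ℝ (Fin 3))) (y : EuclideanSpace ℝ (Fin 3)) :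
    sSup ({0} ∪ {t : ℝ | ∃ ε : ℝ, 1 / 50 < ε ∧ ε ≤ 3 / 20 ∧ t = ε ^ 2 - (1 / 50) ^ 2 ∧
      ¬ IsTwoShellGoodSet ε (47 / 50) 1 Y y}) ≤ (3 / 20 : ℝ) ^ 2 - (1 / 50) ^ 2 := by
  refine csSup_le (misfitSet_nonempty Y y) ?_
  rintro t (ht | ⟨ε, hε0, hεθ, rfl, -⟩)
  · rw [Set.mem_singleton_iff] at ht
    rw [ht]
    norm_num
  · have h1 : ε ^ 2 ≤ (3 / 20 : ℝ) ^ 2 := pow_le_pow_left₀ (by linarith) hεθ 2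
    linarith

/-- **Floor.**  At a `1/50`-GOOD point the misfit set is `{0}` in effect, so its supremum is `0`:
a `1/50`-good point is `ε`-good for every `ε ≥ 1/50` (`IsTwoShellGoodSet.mono`). [folklore] -/
theorem misfitSet_sSup_eq_zero_of_good {Y : Set (EuclideanSpace ℝ (Fin 3))}
    {y : EuclideanSpace ℝ (Fin 3)} (hgood : IsTwoShellGoodSet (1 / 50) (47 / 50) 1 Y y) :
    sSup ({0} ∪ {t : ℝ | ∃ ε : ℝ, 1 / 50 < ε ∧ ε ≤ 3 / 20 ∧ t = ε ^ 2 - (1 / 50) ^ 2 ∧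
      ¬ IsTwoShellGoodSet ε (47 / 50) 1 Y y}) = 0 := by
  refine le_antisymm (csSup_le (misfitSet_nonempty Y y) ?_) (misfitSet_sSup_nonneg Y y)
  rintro t (ht | ⟨ε, hε0, -, -, hbad⟩)
  · rw [Set.mem_singleton_iff] at ht
    rw [ht]
  · exact absurd (hgood.mono hε0.le (by norm_num)) hbad

/-- **Pointwise sandwich, upper half**: `m_y ≤ ((3/20)² − (1/50)²) · [y is 1/50-bad]`, summed
over the motif: `Σ_{y ∈ motif} m_y ≤ ((3/20)² − (1/50)²) · #{y ∈ motif : y is 1/50-bad}`.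
[folklore] -/
theorem sum_misfit_le_mul_card_bad (P : PeriodicConfiguration 3) :
    ∑ y ∈ P.motif,
        sSup ({0} ∪ {t : ℝ | ∃ ε : ℝ, 1 / 50 < ε ∧ ε ≤ 3 / 20 ∧ t = ε ^ 2 - (1 / 50) ^ 2 ∧
          ¬ IsTwoShellGoodSet ε (47 / 50) 1 P.points y}) ≤
      ((3 / 20 : ℝ) ^ 2 - (1 / 50) ^ 2) *
        ((P.motif.filter fun y => ¬ IsTwoShellGoodSet (1 / 50) (47 / 50) 1 P.points y).card : ℝ) := by
  rw [← Finset.sum_filter_add_sum_filter_not P.motif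
    (fun y => ¬ IsTwoShellGoodSet (1 / 50) (47 / 50) 1 P.points y)]
  have hgood : ∑ y ∈ P.motif.filter (fun y => ¬¬ IsTwoShellGoodSet (1 / 50) (47 / 50) 1 P.points y),
      sSup ({0} ∪ {t : ℝ | ∃ ε : ℝ, 1 / 50 < ε ∧ ε ≤ 3 / 20 ∧ t = ε ^ 2 - (1 / 50) ^ 2 ∧
        ¬ IsTwoShellGoodSet ε (47 / 50) 1 P.points y}) = 0 := by
    refine Finset.sum_eq_zero fun y hy => ?_
    exact misfitSet_sSup_eq_zero_of_good (not_not.1 (Finset.mem_filter.1 hy).2)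
  rw [hgood, add_zero]
  calc ∑ y ∈ P.motif.filter (fun y => ¬ IsTwoShellGoodSet (1 / 50) (47 / 50) 1 P.points y),
        sSup ({0} ∪ {t : ℝ | ∃ ε : ℝ, 1 / 50 < ε ∧ ε ≤ 3 / 20 ∧ t = ε ^ 2 - (1 / 50) ^ 2 ∧
          ¬ IsTwoShellGoodSet ε (47 / 50) 1 P.points y})
      ≤ ∑ _y ∈ P.motif.filter (fun y => ¬ IsTwoShellGoodSet (1 / 50) (47 / 50) 1 P.points y),
          ((3 / 20 : ℝ) ^ 2 - (1 / 50) ^ 2) :=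
        Finset.sum_le_sum fun y _ => misfitSet_sSup_le P.points y
    _ = ((3 / 20 : ℝ) ^ 2 - (1 / 50) ^ 2) *
        ((P.motif.filter fun y => ¬ IsTwoShellGoodSet (1 / 50) (47 / 50) 1 P.points y).card : ℝ) := by
        rw [Finset.sum_const, nsmul_eq_mul, mul_comm]

/-- **Lower bread: the torus two-shell gap at tolerance `1/50` implies card A's C⁺** (with
`c = g / ((3/20)² − (1/50)²)`): the motif mean of the misfit is at most `((3/20)² − (1/50)²)`
times the `1/50`-bad fraction (`sum_misfit_le_mul_card_bad`). [folklore] -/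
theorem torusQMC_of_torusGap_fiftieth
    (h : ∃ g : ℝ, 0 < g ∧ ∀ P : PeriodicConfiguration 3,
        (∀ u ∈ P.points, ∀ v ∈ P.points, u ≠ v → (1 / 3 : ℝ) ≤ dist u v) →
        (⨅ Q : PeriodicConfiguration 3, Q.energyPerParticle lennardJones)
          + g * ((P.motif.filter fun y => ¬ IsTwoShellGoodSet (1 / 50) (47 / 50) 1 P.points y).card : ℝ)
              / (P.motif.card : ℝ)
          ≤ P.energyPerParticle lennardJones) :
    ∃ c : ℝ, 0 < c ∧ ∀ P : PeriodicConfiguration 3,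
        (∀ u ∈ P.points, ∀ v ∈ P.points, u ≠ v → (1 / 3 : ℝ) ≤ dist u v) →
        (⨅ Q : PeriodicConfiguration 3, Q.energyPerParticle lennardJones)
          + c * ((P.motif.card : ℝ)⁻¹ * ∑ y ∈ P.motif,
              sSup ({0} ∪ {t : ℝ | ∃ ε : ℝ, 1 / 50 < ε ∧ ε ≤ 3 / 20 ∧ t = ε ^ 2 - (1 / 50) ^ 2 ∧
                ¬ IsTwoShellGoodSet ε (47 / 50) 1 P.points y}))
          ≤ P.energyPerParticle lennardJones := by
  obtain ⟨g, hg, hG⟩ := h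
  have hK : (0 : ℝ) < (3 / 20 : ℝ) ^ 2 - (1 / 50) ^ 2 := by norm_num
  refine ⟨g / ((3 / 20 : ℝ) ^ 2 - (1 / 50) ^ 2), div_pos hg hK, fun P hsep => ?_⟩
  have key := hG P hsep
  have hm : (0 : ℝ) < (P.motif.card : ℝ) := Nat.cast_pos.2 (Finset.card_pos.2 P.motif_nonempty)
  have h1 := sum_misfit_le_mul_card_bad P
  -- `c · (#motif)⁻¹ · Σ m_y ≤ c · (#motif)⁻¹ · K · #bad = g · #bad / #motif`
  have h2 : g / ((3 / 20 : ℝ) ^ 2 - (1 / 50) ^ 2) * ((P.motif.card : ℝ)⁻¹ * ∑ y ∈ P.motif,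
        sSup ({0} ∪ {t : ℝ | ∃ ε : ℝ, 1 / 50 < ε ∧ ε ≤ 3 / 20 ∧ t = ε ^ 2 - (1 / 50) ^ 2 ∧
          ¬ IsTwoShellGoodSet ε (47 / 50) 1 P.points y})) ≤
      g * ((P.motif.filter fun y => ¬ IsTwoShellGoodSet (1 / 50) (47 / 50) 1 P.points y).card : ℝ)
        / (P.motif.card : ℝ) := by
    have h3 := mul_le_mul_of_nonneg_left h1 (inv_nonneg.2 hm.le)
    have h4 := mul_le_mul_of_nonneg_left h3 (div_pos hg hK).le
    have h5 : g / ((3 / 20 : ℝ) ^ 2 - (1 / 50) ^ 2) * ((P.motif.card : ℝ)⁻¹ *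
        (((3 / 20 : ℝ) ^ 2 - (1 / 50) ^ 2) *
          ((P.motif.filter fun y => ¬ IsTwoShellGoodSet (1 / 50) (47 / 50) 1 P.points y).card : ℝ))) =
        g * ((P.motif.filter fun y => ¬ IsTwoShellGoodSet (1 / 50) (47 / 50) 1 P.points y).card : ℝ)
          / (P.motif.card : ℝ) := by
      field_simp
    linarith [h4, h5.le, h5.ge]
  linarith [h2, key]

/-- At an `ε`-bad point with `1/50 < ε ≤ 3/20` the supremum of the misfit set is at least
`ε² − (1/50)²` (`le_csSup`). [folklore] -/
theorem sq_sub_sq_le_misfitSet_sSup_of_bad {ε : ℝ} (hε0 : 1 / 50 < ε) (hεθ : ε ≤ 3 / 20)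
    {Y : Set (EuclideanSpace ℝ (Fin 3))} {y : EuclideanSpace ℝ (Fin 3)}
    (hbad : ¬ IsTwoShellGoodSet ε (47 / 50) 1 Y y) :
    ε ^ 2 - (1 / 50) ^ 2 ≤
      sSup ({0} ∪ {t : ℝ | ∃ ε : ℝ, 1 / 50 < ε ∧ ε ≤ 3 / 20 ∧ t = ε ^ 2 - (1 / 50) ^ 2 ∧
        ¬ IsTwoShellGoodSet ε (47 / 50) 1 Y y}) :=
  le_csSup (misfitSet_bddAbove Y y) (Set.mem_union_right _ ⟨ε, hε0, hεθ, rfl, hbad⟩)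

/-- Counting against the misfit sum at tolerance `ε ∈ (1/50, 3/20]`:
`(ε² − (1/50)²) · #{y ∈ motif : y is ε-bad} ≤ Σ_{y ∈ motif} m_y`. [folklore] -/
theorem mul_card_bad_le_sum_misfit_of {ε : ℝ} (hε0 : 1 / 50 < ε) (hεθ : ε ≤ 3 / 20)
    (P : PeriodicConfiguration 3) :
    (ε ^ 2 - (1 / 50) ^ 2) *
        ((P.motif.filter fun y => ¬ IsTwoShellGoodSet ε (47 / 50) 1 P.points y).card : ℝ) ≤
      ∑ y ∈ P.motif,
        sSup ({0} ∪ {t : ℝ | ∃ ε : ℝ, 1 / 50 < ε ∧ ε ≤ 3 / 20 ∧ t = ε ^ 2 - (1 / 50) ^ 2 ∧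
          ¬ IsTwoShellGoodSet ε (47 / 50) 1 P.points y}) := by
  calc (ε ^ 2 - (1 / 50) ^ 2) *
        ((P.motif.filter fun y => ¬ IsTwoShellGoodSet ε (47 / 50) 1 P.points y).card : ℝ)
      = ∑ _y ∈ (P.motif.filter fun y => ¬ IsTwoShellGoodSet ε (47 / 50) 1 P.points y),
          (ε ^ 2 - (1 / 50) ^ 2) := by
        rw [Finset.sum_const, nsmul_eq_mul, mul_comm]
    _ ≤ ∑ y ∈ (P.motif.filter fun y => ¬ IsTwoShellGoodSet ε (47 / 50) 1 P.points y),
          sSup ({0} ∪ {t : ℝ | ∃ ε : ℝ, 1 / 50 < ε ∧ ε ≤ 3 / 20 ∧ t = ε ^ 2 - (1 / 50) ^ 2 ∧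
            ¬ IsTwoShellGoodSet ε (47 / 50) 1 P.points y}) :=
        Finset.sum_le_sum fun y hy =>
          sq_sub_sq_le_misfitSet_sSup_of_bad hε0 hεθ (Finset.mem_filter.1 hy).2
    _ ≤ ∑ y ∈ P.motif,
          sSup ({0} ∪ {t : ℝ | ∃ ε : ℝ, 1 / 50 < ε ∧ ε ≤ 3 / 20 ∧ t = ε ^ 2 - (1 / 50) ^ 2 ∧
            ¬ IsTwoShellGoodSet ε (47 / 50) 1 P.points y}) :=
        Finset.sum_le_sum_of_subset_of_nonneg (Finset.filter_subset _ _)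
          fun y _ _ => misfitSet_sSup_nonneg P.points y

/-- **Upper bread: card A's C⁺ implies the torus two-shell gap at EVERY tolerance
`ε ∈ (1/50, 3/20]`**, with `g = c (ε² − (1/50)²)` (so `g → 0` as `ε ↓ 1/50`; the landed
`stub_torusSlice` is `ε = 1/20`, `g = 21c/10⁴`). [folklore] -/
theorem torusGap_of_torusQMC {ε : ℝ} (hε0 : 1 / 50 < ε) (hεθ : ε ≤ 3 / 20)
    (h : ∃ c : ℝ, 0 < c ∧ ∀ P : PeriodicConfiguration 3,
        (∀ u ∈ P.points, ∀ v ∈ P.points, u ≠ v → (1 / 3 : ℝ) ≤ dist u v) →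
        (⨅ Q : PeriodicConfiguration 3, Q.energyPerParticle lennardJones)
          + c * ((P.motif.card : ℝ)⁻¹ * ∑ y ∈ P.motif,
              sSup ({0} ∪ {t : ℝ | ∃ ε : ℝ, 1 / 50 < ε ∧ ε ≤ 3 / 20 ∧ t = ε ^ 2 - (1 / 50) ^ 2 ∧
                ¬ IsTwoShellGoodSet ε (47 / 50) 1 P.points y}))
          ≤ P.energyPerParticle lennardJones) :
    ∃ g : ℝ, 0 < g ∧ ∀ P : PeriodicConfiguration 3,
        (∀ u ∈ P.points, ∀ v ∈ P.points, u ≠ v → (1 / 3 : ℝ) ≤ dist u v) →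
        (⨅ Q : PeriodicConfiguration 3, Q.energyPerParticle lennardJones)
          + g * ((P.motif.filter fun y => ¬ IsTwoShellGoodSet ε (47 / 50) 1 P.points y).card : ℝ)
              / (P.motif.card : ℝ)
          ≤ P.energyPerParticle lennardJones := by
  obtain ⟨c, hc, hP⟩ := h
  have hgap : (0 : ℝ) < ε ^ 2 - (1 / 50) ^ 2 := by nlinarith
  refine ⟨c * (ε ^ 2 - (1 / 50) ^ 2), mul_pos hc hgap, fun P hsep => ?_⟩
  have key := hP P hsep
  have hm : (0 : ℝ) < (P.motif.card : ℝ) := Nat.cast_pos.2 (Finset.card_pos.2 P.motif_nonempty)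
  have h2 := mul_le_mul_of_nonneg_left
    (mul_le_mul_of_nonneg_left (mul_card_bad_le_sum_misfit_of hε0 hεθ P) hc.le) (inv_nonneg.2 hm.le)
  rw [div_eq_mul_inv]
  linarith [h2, key]

/-- **The torus two-shell gap is an up-set in the tolerance**: `TorusGap(ε, g) → TorusGap(ε', g)`
for `ε ≤ ε'` — the `ε'`-bad motif points are `ε`-bad (`IsTwoShellGoodSet.mono`). [folklore] -/
theorem torusGap_mono {ε ε' g : ℝ} (hε : ε ≤ ε') (hg : 0 ≤ g)
    (h : ∀ P : PeriodicConfiguration 3,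
        (∀ u ∈ P.points, ∀ v ∈ P.points, u ≠ v → (1 / 3 : ℝ) ≤ dist u v) →
        (⨅ Q : PeriodicConfiguration 3, Q.energyPerParticle lennardJones)
          + g * ((P.motif.filter fun y => ¬ IsTwoShellGoodSet ε (47 / 50) 1 P.points y).card : ℝ)
              / (P.motif.card : ℝ)
          ≤ P.energyPerParticle lennardJones)
    (P : PeriodicConfiguration 3)
    (hsep : ∀ u ∈ P.points, ∀ v ∈ P.points, u ≠ v → (1 / 3 : ℝ) ≤ dist u v) :
    (⨅ Q : PeriodicConfiguration 3, Q.energyPerParticle lennardJones)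
      + g * ((P.motif.filter fun y => ¬ IsTwoShellGoodSet ε' (47 / 50) 1 P.points y).card : ℝ)
          / (P.motif.card : ℝ)
      ≤ P.energyPerParticle lennardJones := by
  have key := h P hsep
  have hm : (0 : ℝ) < (P.motif.card : ℝ) := Nat.cast_pos.2 (Finset.card_pos.2 P.motif_nonempty)
  have hsub : (P.motif.filter fun y => ¬ IsTwoShellGoodSet ε' (47 / 50) 1 P.points y) ⊆
      (P.motif.filter fun y => ¬ IsTwoShellGoodSet ε (47 / 50) 1 P.points y) := by
    intro y hy
    rw [Finset.mem_filter] at hy ⊢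
    exact ⟨hy.1, fun hgood => hy.2 (hgood.mono hε (by norm_num))⟩
  have hcard : ((P.motif.filter fun y => ¬ IsTwoShellGoodSet ε' (47 / 50) 1 P.points y).card : ℝ) ≤
      ((P.motif.filter fun y => ¬ IsTwoShellGoodSet ε (47 / 50) 1 P.points y).card : ℝ) := by
    exact_mod_cast Finset.card_le_card hsub
  have h3 : g * ((P.motif.filter fun y => ¬ IsTwoShellGoodSet ε' (47 / 50) 1 P.points y).card : ℝ)
        / (P.motif.card : ℝ) ≤
      g * ((P.motif.filter fun y => ¬ IsTwoShellGoodSet ε (47 / 50) 1 P.points y).card : ℝ)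
        / (P.motif.card : ℝ) :=
    div_le_div_of_nonneg_right (mul_le_mul_of_nonneg_left hcard hg) hm.le
  linarith

/-- **The sandwich, stated once**: the torus gap at tolerance `1/50` implies card A's C⁺, which
implies the torus gap at tolerance `1/20` — the statement kernel-equivalent to the crux
(`CoerciveTwoShellGapBlocks.coerciveTwoShellGap_iff_torusTwoShellGap`). [folklore] -/
theorem torusGap_twentieth_of_torusGap_fiftieth
    (h : ∃ g : ℝ, 0 < g ∧ ∀ P : PeriodicConfiguration 3,
        (∀ u ∈ P.points, ∀ v ∈ P.points, u ≠ v → (1 / 3 : ℝ) ≤ dist u v) →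
        (⨅ Q : PeriodicConfiguration 3, Q.energyPerParticle lennardJones)
          + g * ((P.motif.filter fun y => ¬ IsTwoShellGoodSet (1 / 50) (47 / 50) 1 P.points y).card : ℝ)
              / (P.motif.card : ℝ)
          ≤ P.energyPerParticle lennardJones) :
    ∃ g : ℝ, 0 < g ∧ ∀ P : PeriodicConfiguration 3,
        (∀ u ∈ P.points, ∀ v ∈ P.points, u ≠ v → (1 / 3 : ℝ) ≤ dist u v) →
        (⨅ Q : PeriodicConfiguration 3, Q.energyPerParticle lennardJones)
          + g * ((P.motif.filter fun y => ¬ IsTwoShellGoodSet (1 / 20) (47 / 50) 1 P.points y).card : ℝ)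
              / (P.motif.card : ℝ)
          ≤ P.energyPerParticle lennardJones :=
  torusGap_of_torusQMC (by norm_num) (by norm_num) (torusQMC_of_torusGap_fiftieth h)


/-- **Registered sub-goal `stub_sandwich`** (lead, line `Sketch`, cycle 2; not part of the
composition `CoerciveTwoShellGap_of`): the two breads at once — the torus two-shell gap at
tolerance `1/50` implies card A's C⁺, and C⁺ implies the torus two-shell gap at every tolerance
`ε ∈ (1/50, 3/20]`. [folklore] -/
theorem stub_sandwich :
    ((∃ g : ℝ, 0 < g ∧ (∀ P : PeriodicConfiguration 3,
        (∀ u ∈ P.points, ∀ v ∈ P.points, u ≠ v → (1 / 3 : ℝ) ≤ dist u v) →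
        (⨅ Q : PeriodicConfiguration 3, Q.energyPerParticle lennardJones)
          + g * ((P.motif.filter fun y => ¬ IsTwoShellGoodSet (1 / 50) (47 / 50) 1 P.points y).card : ℝ)
              / (P.motif.card : ℝ)
          ≤ P.energyPerParticle lennardJones)) →
      (∃ c : ℝ, 0 < c ∧ ∀ P : PeriodicConfiguration 3,
        (∀ u ∈ P.points, ∀ v ∈ P.points, u ≠ v → (1 / 3 : ℝ) ≤ dist u v) →
        (⨅ Q : PeriodicConfiguration 3, Q.energyPerParticle lennardJones)
          + c * ((P.motif.card : ℝ)⁻¹ * ∑ y ∈ P.motif,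
              sSup ({0} ∪ {t : ℝ | ∃ ε : ℝ, 1 / 50 < ε ∧ ε ≤ 3 / 20 ∧ t = ε ^ 2 - (1 / 50) ^ 2 ∧
                ¬ IsTwoShellGoodSet ε (47 / 50) 1 P.points y}))
          ≤ P.energyPerParticle lennardJones)) ∧
    (∀ ε : ℝ, 1 / 50 < ε → ε ≤ 3 / 20 →
      (∃ c : ℝ, 0 < c ∧ ∀ P : PeriodicConfiguration 3,
        (∀ u ∈ P.points, ∀ v ∈ P.points, u ≠ v → (1 / 3 : ℝ) ≤ dist u v) →
        (⨅ Q : PeriodicConfiguration 3, Q.energyPerParticle lennardJones)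
          + c * ((P.motif.card : ℝ)⁻¹ * ∑ y ∈ P.motif,
              sSup ({0} ∪ {t : ℝ | ∃ ε : ℝ, 1 / 50 < ε ∧ ε ≤ 3 / 20 ∧ t = ε ^ 2 - (1 / 50) ^ 2 ∧
                ¬ IsTwoShellGoodSet ε (47 / 50) 1 P.points y}))
          ≤ P.energyPerParticle lennardJones) →
      ∃ g : ℝ, 0 < g ∧ (∀ P : PeriodicConfiguration 3,
        (∀ u ∈ P.points, ∀ v ∈ P.points, u ≠ v → (1 / 3 : ℝ) ≤ dist u v) →
        (⨅ Q : PeriodicConfiguration 3, Q.energyPerParticle lennardJones)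
          + g * ((P.motif.filter fun y => ¬ IsTwoShellGoodSet ε (47 / 50) 1 P.points y).card : ℝ)
              / (P.motif.card : ℝ)
          ≤ P.energyPerParticle lennardJones)) :=
  ⟨torusQMC_of_torusGap_fiftieth, fun _ hε0 hεθ h => torusGap_of_torusQMC hε0 hεθ h⟩

end Summit.AtomisticToContinuum.Crystallization.Theorems.CoerciveTwoShellGapSandwich

end
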